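import Summits.AtomisticToContinuum.FouriersLaw.Theorems.EmbeddedDrudeMourreFGRGapClosingA
import Literature.Analysis.InnerProduct.WeakSubsequence
import Literature.Analysis.FluidPDE.L3WeakCompactness

/-!
# FGRGap, line `fold-jet-rigidity`, stub S4b (gap closing) — part B: the closing argument

Support file for crux `EmbeddedDrudeMourre.FGRGap` (item stmt-AtomisticToContinuum-12595), stub
`stub_gapClosing`. Pure functional analysis on `L²(cell)`, parameter-free in `ω₂ a b`:

**Theorem** (`hasOddSectorGap_of_convex_lsc_ess_nonull`, = helper stub `stub_gapClosing_partB`).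
Let `q = boltzmannForm ω₂ a b`. Assume
(CONV) `q(s f + t g) ≤ s q(f) + t q(g)` for `2π`-periodic measurable `f, g`, `s, t ≥ 0`,
`s + t = 1`;
(LSC) `q f ≤ liminf q (F n)` whenever periodic measurable `F n → f` a.e. on the cell;
(ESS) `∃ v₀ > 0`, `liminf q (f n) ≥ v₀` along every weakly-null sequence of odd periodic measurable
unit vectors;
(NONULL) every odd periodic measurable `f ∈ L²(cell)` with `q f = 0` has `‖f‖ = 0`.
Then `HasOddSectorGap ω₂ a b`.

**Proof.** If not, there are odd periodic measurable `u n` with `‖u n‖ = 1`, `q(u n) < 1/(n+1)`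
(`exists_normalised_seq_of_not_gap`). In the Hilbert space `H = Lp ℝ 2 (volume.restrict cell)`
a subsequence converges weakly, `u ⇀ W`
(`Literature.Analysis.InnerProduct.exists_strictMono_tendsto_inner_of_norm_le`). If `W = 0` the
subsequence is weakly null in the typed sense (pairings are inner products, part A), and (ESS)
gives `v₀ ≤ liminf q = 0`. If `W ≠ 0`: the sets
`A_ε = {U ∈ H | U has an odd periodic measurable representative g with q g ≤ ε}` are convex (CONV)
and closed (LSC + a.e.-convergent subsequences + periodisation/oddisation of representatives,
part A), hence weakly sequentially closed
(`Literature.Analysis.FluidPDE.mem_of_tendsto_inner_of_convex_isClosed`, Mazur); the tail of the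
subsequence lies in `A_ε`, so `W ∈ A_ε` for every `ε > 0`; representatives of `W` agree a.e. and
(LSC) on constant sequences makes `q` a class function, so one representative is an odd null vector
of positive norm, contradicting (NONULL).

References: H. Brezis, *Functional Analysis, Sobolev Spaces and PDE* (Springer 2011), Thm. 3.7,
Thm. 3.18, Cor. 3.8 (Mazur). [Brezis2011]
-/

noncomputable section

open MeasureTheory Set Real Filter Topology
open scoped ENNReal
open Literature.MathematicalPhysics.KineticTheory.PhononBoltzmann
open Summit.AtomisticToContinuum.FouriersLaw.Theorems.FGRGap

namespace Summit.AtomisticToContinuum.FouriersLaw.Theorems.FGRGap.FoldJetRigidity.Closing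

/-! ## Normalisation of a violating sequence -/

/-- If the odd-sector gap fails, there is a sequence of odd `2π`-periodic measurable unit vectors
of `L²(cell)` along which the form tends to zero: `q(u n) < 1/(n+1)` (pick `q(f n) < ‖f n‖²/(n+1)`
and normalise with `boltzmannForm_const_mul`, `cellNormSq_const_mul`). [folklore] -/
theorem exists_normalised_seq_of_not_gap {ω₂ a b : ℝ} (h : ¬ HasOddSectorGap ω₂ a b) :
    ∃ u : ℕ → ℝ → ℝ, (∀ n, Function.Periodic (u n) (2 * π)) ∧ (∀ n, Measurable (u n)) ∧
      (∀ n, Function.Odd (u n)) ∧ (∀ n, cellNormSq (u n) = 1) ∧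
      ∀ n, boltzmannForm ω₂ a b (u n) < ENNReal.ofReal (1 / ((n : ℝ) + 1)) := by
  unfold HasOddSectorGap at h
  push Not at h
  choose f hper hmeas hodd hfin hlt using fun n : ℕ => h (1 / ((n : ℝ) + 1)) (by positivity)
  have hN0 : ∀ n, cellNormSq (f n) ≠ 0 := fun n h0 => by
    have := hlt n
    rw [h0, mul_zero] at this
    exact ENNReal.not_lt_zero this
  have hNtop : ∀ n, cellNormSq (f n) ≠ ∞ := fun n => (hfin n).ne
  have hNpos : ∀ n, 0 < (cellNormSq (f n)).toReal := fun n => ENNReal.toReal_pos (hN0 n) (hNtop n)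
  set t : ℕ → ℝ := fun n => 1 / Real.sqrt (cellNormSq (f n)).toReal with ht
  have htpos : ∀ n, 0 < t n := fun n => by
    rw [ht]
    exact div_pos one_pos (Real.sqrt_pos.2 (hNpos n))
  have ht2 : ∀ n, ENNReal.ofReal (t n ^ 2) * cellNormSq (f n) = 1 := fun n => by
    rw [ht]
    simp only
    rw [div_pow, one_pow, Real.sq_sqrt (hNpos n).le, one_div, ENNReal.ofReal_inv_of_pos (hNpos n),
      ENNReal.ofReal_toReal (hNtop n), ENNReal.inv_mul_cancel (hN0 n) (hNtop n)]
  refine ⟨fun n k => t n * f n k, fun n k => ?_, fun n => (hmeas n).const_mul _, fun n k => ?_,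
    fun n => ?_, fun n => ?_⟩
  · show t n * f n (k + 2 * π) = t n * f n k
    rw [hper n k]
  · show t n * f n (-k) = -(t n * f n k)
    rw [hodd n k]
    ring
  · rw [cellNormSq_const_mul, ht2]
  · rw [boltzmannForm_const_mul]
    have h0 : ENNReal.ofReal (t n ^ 2) ≠ 0 := by
      have := pow_pos (htpos n) 2
      exact fun h0 => absurd (ENNReal.ofReal_eq_zero.1 h0) (not_le.2 this)
    calc ENNReal.ofReal (t n ^ 2) * boltzmannForm ω₂ a b (f n)
        < ENNReal.ofReal (t n ^ 2) * (ENNReal.ofReal (1 / ((n : ℝ) + 1)) * cellNormSq (f n)) :=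
          (ENNReal.mul_lt_mul_iff_right h0 ENNReal.ofReal_ne_top).2 (hlt n)
      _ = ENNReal.ofReal (1 / ((n : ℝ) + 1)) * (ENNReal.ofReal (t n ^ 2) * cellNormSq (f n)) := by
          ring
      _ = ENNReal.ofReal (1 / ((n : ℝ) + 1)) := by rw [ht2, mul_one]

/-! ## Lower semicontinuity makes the form a function of the a.e.-class -/

/-- Under lower semicontinuity along a.e.-convergent sequences (hypothesis (LSC) of the stub,
applied to constant sequences), `2π`-periodic measurable functions that agree a.e. on the cell
have the same form. [folklore] -/
theorem boltzmannForm_congr_ae_of_lsc {ω₂ a b : ℝ}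
    (hlsc : ∀ (F : ℕ → ℝ → ℝ) (f : ℝ → ℝ), (∀ n, Function.Periodic (F n) (2 * π)) →
      (∀ n, Measurable (F n)) → Function.Periodic f (2 * π) → Measurable f →
      (∀ᵐ k ∂(MeasureTheory.volume.restrict (Set.Ioc (-π) π)),
        Filter.Tendsto (fun n => F n k) Filter.atTop (nhds (f k))) →
      boltzmannForm ω₂ a b f ≤ Filter.liminf (fun n => boltzmannForm ω₂ a b (F n)) Filter.atTop)
    {f g : ℝ → ℝ} (hf : Function.Periodic f (2 * π)) (hfm : Measurable f)
    (hg : Function.Periodic g (2 * π)) (hgm : Measurable g)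
    (hfg : f =ᵐ[volume.restrict (Ioc (-π) π)] g) :
    boltzmannForm ω₂ a b f = boltzmannForm ω₂ a b g := by
  apply le_antisymm
  · have h := hlsc (fun _ => g) f (fun _ => hg) (fun _ => hgm) hf hfm
      (hfg.mono fun k hk => by rw [hk]; exact tendsto_const_nhds)
    rwa [liminf_const] at h
  · have h := hlsc (fun _ => f) g (fun _ => hf) (fun _ => hfm) hg hgm
      (hfg.mono fun k hk => by rw [← hk]; exact tendsto_const_nhds)
    rwa [liminf_const] at h

/-! ## The sublevel sets of the form among odd classes: convex and closed -/

/-- CONVEXITY of the form on periodic measurable functions (hypothesis (CONV)) makes the set of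
classes `U ∈ L²(cell)` having an odd `2π`-periodic measurable representative `g` with
`q g ≤ ε` convex. [folklore] -/
theorem convex_sublevel {ω₂ a b : ℝ}
    (hconv : ∀ (f g : ℝ → ℝ) (s t : ℝ), Function.Periodic f (2 * π) → Measurable f →
      Function.Periodic g (2 * π) → Measurable g → 0 ≤ s → 0 ≤ t → s + t = 1 →
      boltzmannForm ω₂ a b (fun k => s * f k + t * g k) ≤
        ENNReal.ofReal s * boltzmannForm ω₂ a b f + ENNReal.ofReal t * boltzmannForm ω₂ a b g)
    (ε : ℝ) :
    Convex ℝ {U : Lp ℝ 2 (volume.restrict (Ioc (-π) π)) | ∃ g : ℝ → ℝ,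
      Function.Periodic g (2 * π) ∧ Measurable g ∧ Function.Odd g ∧
      g =ᵐ[volume.restrict (Ioc (-π) π)] U ∧ boltzmannForm ω₂ a b g ≤ ENNReal.ofReal ε} := by
  intro U₁ h₁ U₂ h₂ s t hs ht hst
  obtain ⟨g₁, hp1, hm1, ho1, hae1, hq1⟩ := h₁
  obtain ⟨g₂, hp2, hm2, ho2, hae2, hq2⟩ := h₂
  refine ⟨fun k => s * g₁ k + t * g₂ k, fun k => ?_, (hm1.const_mul s).add (hm2.const_mul t),
    fun k => ?_, lincomb_ae_eq hae1 hae2 s t, ?_⟩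
  · show s * g₁ (k + 2 * π) + t * g₂ (k + 2 * π) = s * g₁ k + t * g₂ k
    rw [hp1 k, hp2 k]
  · show s * g₁ (-k) + t * g₂ (-k) = -(s * g₁ k + t * g₂ k)
    rw [ho1 k, ho2 k]
    ring
  · calc boltzmannForm ω₂ a b (fun k => s * g₁ k + t * g₂ k)
        ≤ ENNReal.ofReal s * boltzmannForm ω₂ a b g₁ + ENNReal.ofReal t * boltzmannForm ω₂ a b g₂ :=
          hconv g₁ g₂ s t hp1 hm1 hp2 hm2 hs ht hst
      _ ≤ ENNReal.ofReal s * ENNReal.ofReal ε + ENNReal.ofReal t * ENNReal.ofReal ε := by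
          gcongr
      _ = ENNReal.ofReal ε := by
          rw [← add_mul, ← ENNReal.ofReal_add hs ht, hst, ENNReal.ofReal_one, one_mul]

/-- LOWER SEMICONTINUITY along a.e.-convergent sequences (hypothesis (LSC)) makes the same set
closed in `L²(cell)`: a strongly convergent sequence of members has an a.e.-convergent
subsequence, whose limit is periodised and oddised into an admissible representative of the limit
class. [folklore] -/
theorem isClosed_sublevel {ω₂ a b : ℝ}
    (hlsc : ∀ (F : ℕ → ℝ → ℝ) (f : ℝ → ℝ), (∀ n, Function.Periodic (F n) (2 * π)) →
      (∀ n, Measurable (F n)) → Function.Periodic f (2 * π) → Measurable f →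
      (∀ᵐ k ∂(MeasureTheory.volume.restrict (Set.Ioc (-π) π)),
        Filter.Tendsto (fun n => F n k) Filter.atTop (nhds (f k))) →
      boltzmannForm ω₂ a b f ≤ Filter.liminf (fun n => boltzmannForm ω₂ a b (F n)) Filter.atTop)
    (ε : ℝ) :
    IsClosed {U : Lp ℝ 2 (volume.restrict (Ioc (-π) π)) | ∃ g : ℝ → ℝ,
      Function.Periodic g (2 * π) ∧ Measurable g ∧ Function.Odd g ∧
      g =ᵐ[volume.restrict (Ioc (-π) π)] U ∧ boltzmannForm ω₂ a b g ≤ ENNReal.ofReal ε} := by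
  refine IsSeqClosed.isClosed fun x p hx hp => ?_
  choose g hper hmeas hodd hae hq using hx
  obtain ⟨r, hrper, hrmeas, hrae⟩ := exists_periodic_rep p
  obtain ⟨ns, hns, hconv⟩ := exists_subseq_ae_tendsto hp hae hrae
  obtain ⟨r', hr'per, hr'meas, hr'odd, hr'ae⟩ :=
    exists_odd_rep hrper hrmeas (fun i => hodd (ns i)) hconv
  refine ⟨r', hr'per, hr'meas, hr'odd, hr'ae.trans hrae, ?_⟩
  have hconv' : ∀ᵐ k ∂(volume.restrict (Ioc (-π) π)),
      Tendsto (fun i => g (ns i) k) atTop (𝓝 (r' k)) := by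
    filter_upwards [hconv, hr'ae] with k hk hk'
    rwa [hk']
  calc boltzmannForm ω₂ a b r'
      ≤ liminf (fun i => boltzmannForm ω₂ a b (g (ns i))) atTop :=
        hlsc (fun i => g (ns i)) r' (fun i => hper _) (fun i => hmeas _) hr'per hr'meas hconv'
    _ ≤ ENNReal.ofReal ε := liminf_le_of_frequently_le' (Frequently.of_forall fun i => hq (ns i))

/-! ## The closing -/

/-- **Gap closing (the direct method).** If the form `q = boltzmannForm ω₂ a b` is CONVEX on
`2π`-periodic measurable functions, LOWER SEMICONTINUOUS along a.e.-convergent sequences of such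
functions, has the ODD ESSENTIAL GAP (`liminf q ≥ v₀ > 0` along weakly-null sequences of odd
periodic measurable unit vectors of `L²(cell)`), and has NO ODD NULL VECTOR of positive norm, then
it has an odd-sector gap. Proof: otherwise normalise a violating sequence (`q(u n) → 0`,
`‖u n‖ = 1`), extract a weakly convergent subsequence `u ⇀ W` in the Hilbert space `L²(cell)`;
`W = 0` contradicts the essential gap; for `W ≠ 0`, the sublevel sets `{q ≤ ε}` (among classes with
an odd periodic measurable representative) are convex and closed, hence weakly sequentially closed
(Mazur), so `W` has for every `ε > 0` an admissible representative with `q ≤ ε`; all these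
representatives agree a.e., so (lsc on constant sequences) any one of them is an odd null vector of
positive norm. [cite: Brezis2011, Thm. 3.7 (with Thm. 5.2) and Thm. 3.18] -/
theorem hasOddSectorGap_of_convex_lsc_ess_nonull (ω₂ a b : ℝ)
    (hconv : ∀ (f g : ℝ → ℝ) (s t : ℝ), Function.Periodic f (2 * π) → Measurable f →
      Function.Periodic g (2 * π) → Measurable g → 0 ≤ s → 0 ≤ t → s + t = 1 →
      boltzmannForm ω₂ a b (fun k => s * f k + t * g k) ≤
        ENNReal.ofReal s * boltzmannForm ω₂ a b f + ENNReal.ofReal t * boltzmannForm ω₂ a b g)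
    (hlsc : ∀ (F : ℕ → ℝ → ℝ) (f : ℝ → ℝ), (∀ n, Function.Periodic (F n) (2 * π)) →
      (∀ n, Measurable (F n)) → Function.Periodic f (2 * π) → Measurable f →
      (∀ᵐ k ∂(MeasureTheory.volume.restrict (Set.Ioc (-π) π)),
        Filter.Tendsto (fun n => F n k) Filter.atTop (nhds (f k))) →
      boltzmannForm ω₂ a b f ≤ Filter.liminf (fun n => boltzmannForm ω₂ a b (F n)) Filter.atTop)
    (hess : ∃ v₀ : ℝ, 0 < v₀ ∧
      ∀ f : ℕ → ℝ → ℝ, (∀ n, Function.Periodic (f n) (2 * π)) → (∀ n, Measurable (f n)) →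
        (∀ n, Function.Odd (f n)) → (∀ n, cellNormSq (f n) = 1) →
          (∀ φ : ℝ → ℝ, Measurable φ → cellNormSq φ < ∞ →
              Filter.Tendsto (fun n => cellPairing φ (f n)) Filter.atTop (nhds 0)) →
            ENNReal.ofReal v₀ ≤ Filter.liminf (fun n => boltzmannForm ω₂ a b (f n)) Filter.atTop)
    (hnull : ∀ f : ℝ → ℝ, Function.Periodic f (2 * π) → Measurable f → Function.Odd f →
      cellNormSq f < ∞ → boltzmannForm ω₂ a b f = 0 → cellNormSq f = 0) :
    HasOddSectorGap ω₂ a b := by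
  by_contra hgap
  obtain ⟨u, hper, hmeas, hodd, hnorm, hq⟩ := exists_normalised_seq_of_not_gap hgap
  have hmem : ∀ n, MemLp (u n) 2 (volume.restrict (Ioc (-π) π)) := fun n =>
    memLp_two_cell (hmeas n) (by rw [hnorm n]; exact ENNReal.one_lt_top)
  set U : ℕ → Lp ℝ 2 (volume.restrict (Ioc (-π) π)) := fun n => (hmem n).toLp (u n) with hU
  have hU1 : ∀ n, ‖U n‖ ≤ 1 := fun n => (norm_toLp_eq_one (hmem n) (hnorm n)).le
  obtain ⟨σ, W, hσ, -, hweak⟩ :=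
    Literature.Analysis.InnerProduct.exists_strictMono_tendsto_inner_of_norm_le (𝕜 := ℝ) hU1
  have huU : ∀ n, u n =ᵐ[volume.restrict (Ioc (-π) π)] U n := fun n => (hmem n).coeFn_toLp.symm
  -- the form tends to zero along the subsequence
  have hqσ : ∀ n, boltzmannForm ω₂ a b (u (σ n)) ≤ ENNReal.ofReal (1 / ((n : ℝ) + 1)) := fun n => by
    refine (hq (σ n)).le.trans (ENNReal.ofReal_le_ofReal ?_)
    have : (n : ℝ) ≤ σ n := by exact_mod_cast hσ.id_le n
    exact one_div_le_one_div_of_le (by positivity) (by linarith)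
  have hlim0 : Tendsto (fun n : ℕ => ENNReal.ofReal (1 / ((n : ℝ) + 1))) atTop (𝓝 0) := by
    have h := ENNReal.tendsto_ofReal (tendsto_one_div_add_atTop_nhds_zero_nat (𝕜 := ℝ))
    rwa [ENNReal.ofReal_zero] at h
  by_cases hW : W = 0
  · -- Case `W = 0`: the subsequence is weakly null, contradicting the essential gap.
    obtain ⟨v₀, hv₀, hess⟩ := hess
    have hwn : ∀ φ : ℝ → ℝ, Measurable φ → cellNormSq φ < ∞ →
        Tendsto (fun n => cellPairing φ (u (σ n))) atTop (𝓝 0) := by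
      intro φ hφm hφf
      have hφ : MemLp φ 2 (volume.restrict (Ioc (-π) π)) := memLp_two_cell hφm hφf
      have h1 := hweak (hφ.toLp φ)
      rw [hW, inner_zero_right] at h1
      refine h1.congr fun n => ?_
      exact inner_toLp_eq_cellPairing hφ (U (σ n)) (huU (σ n))
    have h2 := hess (fun n => u (σ n)) (fun n => hper _) (fun n => hmeas _) (fun n => hodd _)
      (fun n => hnorm _) hwn
    have h3 : liminf (fun n => boltzmannForm ω₂ a b (u (σ n))) atTop ≤ 0 := by
      calc liminf (fun n => boltzmannForm ω₂ a b (u (σ n))) atTop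
          ≤ liminf (fun n : ℕ => ENNReal.ofReal (1 / ((n : ℝ) + 1))) atTop :=
            liminf_le_liminf (Eventually.of_forall hqσ)
        _ = 0 := hlim0.liminf_eq
    have h4 : ENNReal.ofReal v₀ = 0 := le_antisymm (h2.trans h3) bot_le
    exact absurd (ENNReal.ofReal_eq_zero.1 h4) (not_le.2 hv₀)
  · -- Case `W ≠ 0`: Mazur on the sublevel sets `{q ≤ 1/(m+1)}`.
    have hmemW : ∀ m : ℕ, W ∈ {V : Lp ℝ 2 (volume.restrict (Ioc (-π) π)) | ∃ g : ℝ → ℝ,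
        Function.Periodic g (2 * π) ∧ Measurable g ∧ Function.Odd g ∧
        g =ᵐ[volume.restrict (Ioc (-π) π)] V ∧
        boltzmannForm ω₂ a b g ≤ ENNReal.ofReal (1 / ((m : ℝ) + 1))} := by
      intro m
      refine Literature.Analysis.FluidPDE.mem_of_tendsto_inner_of_convex_isClosed
        (convex_sublevel hconv _) (isClosed_sublevel hlsc _) (v := fun n => U (σ (n + m)))
        (fun n => ⟨u (σ (n + m)), hper _, hmeas _, hodd _, huU _, ?_⟩) (fun z => ?_)
      · refine (hqσ (n + m)).trans (ENNReal.ofReal_le_ofReal ?_)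
        push_cast
        exact one_div_le_one_div_of_le (by positivity)
          (by linarith [(Nat.cast_nonneg n : (0 : ℝ) ≤ n)])
      · have h := (hweak z).comp (tendsto_add_atTop_nat m)
        simp_rw [real_inner_comm z]
        exact h
    choose g hgper hgmeas hgodd hgae hgq using hmemW
    -- all `g m` represent `W`; by (LSC) they have the same form, which is therefore `0`
    have hq0 : boltzmannForm ω₂ a b (g 0) = 0 := by
      refine le_antisymm (ge_of_tendsto' hlim0 fun m => ?_) bot_le
      rw [boltzmannForm_congr_ae_of_lsc hlsc (hgper 0) (hgmeas 0) (hgper m) (hgmeas m)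
        ((hgae 0).trans (hgae m).symm)]
      exact hgq m
    have hfin : cellNormSq (g 0) < ∞ := cellNormSq_lt_top_of_ae_eq W (hgae 0)
    have hne : cellNormSq (g 0) ≠ 0 := cellNormSq_ne_zero_of_ae_eq hW (hgae 0)
    exact hne (hnull (g 0) (hgper 0) (hgmeas 0) (hgodd 0) hfin hq0)

end Summit.AtomisticToContinuum.FouriersLaw.Theorems.FGRGap.FoldJetRigidity.Closing

namespace Summit.AtomisticToContinuum.FouriersLaw.Theorems.FGRGap.FoldJetRigidity

/-- **S4b — GAP CLOSING** (registered stub `stub_gapClosing` of line fold-jet-rigidity, corrected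
signature with the convexity hypothesis): `convex ∧ lsc ∧ odd essential gap ∧ no odd null vector ⇒
odd-sector gap`. [cite: Brezis2011, Thm. 3.7 (with Thm. 5.2) and Thm. 3.18] -/
theorem stub_gapClosing :
    ∀ ω₂ a b : ℝ,
      (∀ (f g : ℝ → ℝ) (s t : ℝ), Function.Periodic f (2 * π) → Measurable f → Function.Periodic g (2 * π) →
          Measurable g → 0 ≤ s → 0 ≤ t → s + t = 1 →
          boltzmannForm ω₂ a b (fun k => s * f k + t * g k) ≤
            ENNReal.ofReal s * boltzmannForm ω₂ a b f + ENNReal.ofReal t * boltzmannForm ω₂ a b g) →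
      (∀ (F : ℕ → ℝ → ℝ) (f : ℝ → ℝ), (∀ n, Function.Periodic (F n) (2 * π)) →
          (∀ n, Measurable (F n)) → Function.Periodic f (2 * π) → Measurable f →
          (∀ᵐ k ∂(MeasureTheory.volume.restrict (Set.Ioc (-π) π)),
            Filter.Tendsto (fun n => F n k) Filter.atTop (nhds (f k))) →
          boltzmannForm ω₂ a b f ≤ Filter.liminf (fun n => boltzmannForm ω₂ a b (F n)) Filter.atTop) →
      (∃ v₀ : ℝ, 0 < v₀ ∧
          ∀ f : ℕ → ℝ → ℝ, (∀ n, Function.Periodic (f n) (2 * π)) → (∀ n, Measurable (f n)) →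
            (∀ n, Function.Odd (f n)) → (∀ n, cellNormSq (f n) = 1) →
              (∀ φ : ℝ → ℝ, Measurable φ → cellNormSq φ < ∞ →
                  Filter.Tendsto (fun n => cellPairing φ (f n)) Filter.atTop (nhds 0)) →
                ENNReal.ofReal v₀ ≤ Filter.liminf (fun n => boltzmannForm ω₂ a b (f n)) Filter.atTop) →
      (∀ f : ℝ → ℝ, Function.Periodic f (2 * π) → Measurable f → Function.Odd f →
          cellNormSq f < ∞ → boltzmannForm ω₂ a b f = 0 → cellNormSq f = 0) →
      HasOddSectorGap ω₂ a b :=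
  fun ω₂ a b hconv hlsc hess hnull =>
    Closing.hasOddSectorGap_of_convex_lsc_ess_nonull ω₂ a b hconv hlsc hess hnull

end Summit.AtomisticToContinuum.FouriersLaw.Theorems.FGRGap.FoldJetRigidity

end
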